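import Literature.Probability.Percolation.CutBlocksFaceFarSymm
import Literature.Probability.Percolation.CollarFaceSum
import HarnessLib

/-!
# The wall faces of the zones of a cut and the total bad event

Topic `Probability/Percolation`.  Support file (definitions and proofs, no named fact) for the named
fact `SchrammSmirnov2011_thm_1_7` (the landing count of the proof of Prop. 4.1, Ann. Probab. 39
(2011), §4): the four finite families of WALL FACES of `CutBlocks.zones` (`upFaces`, `downFaces`,
`rightFaces`, `leftFaces`: tube blocks with a non-tube neighbour above / below / right / left), their
frames and face columns, and the TOTAL BAD EVENT `badAll` (the union of the bad events
`badFace` of all faces).  Its probability is at most the number of faces times `C (m/S)^ε` with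
`S = s/δ - 1` (`real_badAll_le`, from `real_badFace_le` fed with `cleanWindow_of_wallFace*_fit` and
`le_dist_far_face*`), for any zones COMPATIBLE with the digitisation (`Compat`: same tube, collar
containing the ring collar, no squares — clean windows and far distances transfer, `Compat.cleanWindow`,
`Compat.far_subset`).

## References

* O. Schramm, S. Smirnov, *On the scaling limits of planar percolation*, Ann. Probab. 39 (2011)
  1768–1814, arXiv:1101.5820, §4, proof of Prop. 4.1. [SchrammSmirnov2011]
-/

noncomputable section

open MeasureTheory Set Metric Finset
open Literature.Probability.LatticeModels
open scoped Classical

namespace Literature.Probability.Percolation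

namespace CutBlocks

open Seeded Seeded.CollarDatum

variable {s : ℝ} {α : Set ℂ} {δ : ℝ}

/-! ### The four face families -/

/-- The tube blocks as a finite set. [folklore] -/
def tubeFinset (hs : 0 < s) (hα : Bornology.IsBounded α) : Finset (ℤ × ℤ) := (tubeBlocks_finite hs hα).toFinset

/-- Membership in `tubeFinset`. [folklore] -/
@[simp] theorem mem_tubeFinset {hs : 0 < s} {hα : Bornology.IsBounded α} {z : ℤ × ℤ} :
    z ∈ tubeFinset hs hα ↔ z ∈ tubeBlocks s α := Set.Finite.mem_toFinset _

/-- **Upper faces.** [folklore] -/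
def upFaces (hs : 0 < s) (hα : Bornology.IsBounded α) : Finset (ℤ × ℤ) :=
  (tubeFinset hs hα).filter fun z => (z.1, z.2 + 1) ∉ tubeBlocks s α
/-- **Lower faces.** [folklore] -/
def downFaces (hs : 0 < s) (hα : Bornology.IsBounded α) : Finset (ℤ × ℤ) :=
  (tubeFinset hs hα).filter fun z => (z.1, z.2 - 1) ∉ tubeBlocks s α
/-- **Right faces.** [folklore] -/
def rightFaces (hs : 0 < s) (hα : Bornology.IsBounded α) : Finset (ℤ × ℤ) :=
  (tubeFinset hs hα).filter fun z => (z.1 + 1, z.2) ∉ tubeBlocks s α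
/-- **Left faces.** [folklore] -/
def leftFaces (hs : 0 < s) (hα : Bornology.IsBounded α) : Finset (ℤ × ℤ) :=
  (tubeFinset hs hα).filter fun z => (z.1 - 1, z.2) ∉ tubeBlocks s α

/-- Upper faces are wall faces. [folklore] -/
theorem wallFace_of_mem_upFaces {hs : 0 < s} {hα : Bornology.IsBounded α} {z : ℤ × ℤ} (hz : z ∈ upFaces hs hα) :
    WallFace s α z := by
  rw [upFaces, Finset.mem_filter, mem_tubeFinset] at hz; exact ⟨hz.1, hz.2⟩

/-- Lower faces are wall faces. [folklore] -/
theorem wallFaceBottom_of_mem_downFaces {hs : 0 < s} {hα : Bornology.IsBounded α} {z : ℤ × ℤ} (hz : z ∈ downFaces hs hα) :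
    WallFaceBottom s α z := by
  rw [downFaces, Finset.mem_filter, mem_tubeFinset] at hz; exact ⟨hz.1, hz.2⟩

/-- Right faces are wall faces. [folklore] -/
theorem wallFaceRight_of_mem_rightFaces {hs : 0 < s} {hα : Bornology.IsBounded α} {z : ℤ × ℤ} (hz : z ∈ rightFaces hs hα) :
    WallFaceRight s α z := by
  rw [rightFaces, Finset.mem_filter, mem_tubeFinset] at hz; exact ⟨hz.1, hz.2⟩

/-- Left faces are wall faces. [folklore] -/
theorem wallFaceLeft_of_mem_leftFaces {hs : 0 < s} {hα : Bornology.IsBounded α} {z : ℤ × ℤ} (hz : z ∈ leftFaces hs hα) :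
    WallFaceLeft s α z := by
  rw [leftFaces, Finset.mem_filter, mem_tubeFinset] at hz; exact ⟨hz.1, hz.2⟩

/-- The number of faces. [folklore] -/
def numFaces (hs : 0 < s) (hα : Bornology.IsBounded α) : ℕ :=
  (upFaces hs hα).card + (downFaces hs hα).card + (rightFaces hs hα).card + (leftFaces hs hα).card

/-! ### Frames -/

/-- The frame of an upper face. [folklore] -/
def frameUp (s δ : ℝ) (z : ℤ × ℤ) : LatticeSym := downShift s δ z.2
/-- The frame of a lower face. [folklore] -/
def frameDown (s δ : ℝ) (z : ℤ × ℤ) : LatticeSym := LatticeSym.reflY.trans (downShift s δ (-z.2 - 1))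
/-- The frame of a right face. [folklore] -/
def frameRight (s δ : ℝ) (z : ℤ × ℤ) : LatticeSym := LatticeSym.swap.trans (downShift s δ z.1)
/-- The frame of a left face. [folklore] -/
def frameLeft (s δ : ℝ) (z : ℤ × ℤ) : LatticeSym := LatticeSym.swap.trans (LatticeSym.reflY.trans (downShift s δ (-z.1 - 1)))

/-! ### Zones compatible with the digitisation -/

/-- **Zones compatible with the digitisation**: the same tube, a collar containing the ring collar,
no squares (e.g. the zones themselves, or the zones with the lakes of the window filled into the
collar). [folklore] -/
structure Compat (hs : 0 < s) (hδ : 0 < δ) (hα : Bornology.IsBounded α) (𝒵 : Seeded.Zones) : Prop where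
  N_eq : 𝒵.N = (zones hs hδ hα).N
  K_sub : (zones hs hδ hα).K ⊆ 𝒵.K
  SQ_eq : 𝒵.SQ = ∅

/-- The zones are compatible with themselves. [folklore] -/
theorem compat_zones (hs : 0 < s) (hδ : 0 < δ) (hα : Bornology.IsBounded α) : Compat hs hδ hα (zones hs hδ hα) :=
  ⟨rfl, subset_rfl, rfl⟩

namespace Compat

variable {hs : 0 < s} {hδ : 0 < δ} {hα : Bornology.IsBounded α} {𝒵 : Seeded.Zones} (h : Compat hs hδ hα 𝒵)
include h

/-- Far sites of compatible zones are far sites of the digitisation. [folklore] -/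
theorem far_subset : 𝒵.Far ⊆ (zones hs hδ hα).Far := by
  rintro v ⟨hK, hN, -⟩
  refine ⟨fun h' => hK (h.K_sub h'), by rwa [← h.N_eq], by simp⟩

/-- Collar sites of compatible zones are not tube sites. [folklore] -/
theorem not_mem_N_of_mem_K {v : Site 2} (hv : v ∈ 𝒵.K) : v ∉ (zones hs hδ hα).N := fun hN =>
  (Finset.disjoint_left.1 𝒵.disjoint_K_N) hv (by rwa [h.N_eq])

/-- **Clean windows transfer to compatible zones.** [folklore] -/
theorem cleanWindow {ψ : LatticeSym} {j : ℤ} {m R₁ : ℕ} (hW : ((zones hs hδ hα).collar.map ψ).CleanWindow j m R₁) :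
    (𝒵.collar.map ψ).CleanWindow j m R₁ := by
  intro w hw0 hw0' hw1 hw1'
  obtain ⟨hK, hF⟩ := hW w hw0 hw0' hw1 hw1'
  obtain ⟨u, rfl⟩ : ∃ u, w = ψ.σ u := ⟨ψ.σ.symm w, by simp⟩
  rw [Seeded.CollarDatum.mem_map_K_iff, Seeded.Zones.collar_K] at hK ⊢
  rw [Seeded.CollarDatum.mem_map_Far_iff, Seeded.Zones.collar_Far] at hF ⊢
  constructor
  · constructor
    · intro huK
      by_contra hneg
      have huK0 : u ∉ (zones hs hδ hα).K := fun h' => hneg (hK.1 h')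
      have huN : u ∉ (zones hs hδ hα).N := h.not_mem_N_of_mem_K huK
      exact hF ⟨huK0, huN, by simp⟩
    · exact fun h0 => h.K_sub (hK.2 h0)
  · exact fun huF => hF (h.far_subset huF)

end Compat

/-! ### The total bad event -/

/-- **The total bad event** of zones `𝒵` (compatible with the digitisation at scale `s`, mesh `δ`)
at corner width `w₀` and window width `m`. [cite: SchrammSmirnov2011, §4, proof of Prop. 4.1 (the small-bay event)] -/
def badAll (hs : 0 < s) (hα : Bornology.IsBounded α) (δ : ℝ) (𝒵 : Seeded.Zones) (w₀ m : ℕ) : Set (BondConfig (Site 2)) :=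
  (⋃ z ∈ upFaces hs hα, 𝒵.collar.badFace (frameUp s δ z) (faceA s δ z.1) (faceB s δ z.1) w₀ m) ∪
  (⋃ z ∈ downFaces hs hα, 𝒵.collar.badFace (frameDown s δ z) (faceA s δ z.1) (faceB s δ z.1) w₀ m) ∪
  (⋃ z ∈ rightFaces hs hα, 𝒵.collar.badFace (frameRight s δ z) (faceA s δ z.2) (faceB s δ z.2) w₀ m) ∪
  (⋃ z ∈ leftFaces hs hα, 𝒵.collar.badFace (frameLeft s δ z) (faceA s δ z.2) (faceB s δ z.2) w₀ m)

/-- The face columns form a nonempty range when `2 δ ≤ s`. [folklore] -/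
theorem faceA_le_faceB (hδ : 0 < δ) (h2 : 2 * δ ≤ s) (z₁ : ℤ) : faceA s δ z₁ ≤ faceB s δ z₁ := by
  rw [faceA, faceB]
  have h1 : (⌊s * z₁ / δ⌋ : ℝ) ≤ s * z₁ / δ := Int.floor_le _
  have h3 : s * (z₁ + 1) / δ ≤ (⌈s * (z₁ + 1) / δ⌉ : ℝ) := Int.le_ceil _
  have h4 : s * z₁ / δ + 2 ≤ s * (z₁ + 1) / δ := by
    rw [div_add' _ _ _ hδ.ne', div_le_div_iff_of_pos_right hδ]; nlinarith
  have : (⌊s * z₁ / δ⌋ : ℝ) + 2 ≤ (⌈s * (z₁ + 1) / δ⌉ : ℝ) := by linarith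
  have : ⌊s * z₁ / δ⌋ + 2 ≤ ⌈s * (z₁ + 1) / δ⌉ := by exact_mod_cast this
  omega

/-- **The total bad event is small**: `P(badAll) ≤ numFaces · C (m/S)^ε`, `S = s/δ - 1`, for window
widths `m ≥ m₀`, corner width `10 K m`, meshes with `8 δ ≤ s` and `24 K m ≤ s/δ - 1`.
[cite: SchrammSmirnov2011, §4, proof of Prop. 4.1 (the small-bay event has small probability)] -/
theorem real_badAll_le : ∃ C ε : ℝ, ∃ K m₀ : ℕ, 0 < C ∧ 0 < ε ∧ 1 ≤ K ∧
    ∀ (s δ : ℝ) (α : Set ℂ) (hs : 0 < s) (hδ : 0 < δ) (hα : Bornology.IsBounded α) (𝒵 : Seeded.Zones) (m : ℕ),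
      Compat hs hδ hα 𝒵 → m₀ ≤ m → 8 * δ ≤ s → (24 * K * m : ℝ) ≤ s / δ - 1 →
      (bondPercolation (zdGraph 2) half).real (badAll hs hα δ 𝒵 (10 * K * m) m) ≤
        numFaces hs hα * (C * ((m : ℝ) / (s / δ - 1)) ^ ε) := by
  obtain ⟨C, ε, K, m₀, hC, hε, hK, hface⟩ := real_badFace_le
  refine ⟨C, ε, K, m₀, hC, hε, hK, fun s δ α hs hδ hα 𝒵 m h𝒵 hm h8 hS => ?_⟩
  have hδs : δ ≤ s := by linarith
  have h2 : 2 * δ ≤ s := by linarith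
  set S : ℝ := s / δ - 1 with hSdef
  set P := bondPercolation (zdGraph 2) half with hP
  set 𝒞 := 𝒵.collar with h𝒞
  have hFar𝒞 : ∀ u, u ∈ 𝒞.Far → u ∈ (zones hs hδ hα).Far := fun u hu => by
    rw [h𝒞, Seeded.Zones.collar_Far] at hu; exact h𝒵.far_subset hu
  -- each face costs at most `C (m/S)^ε`
  have hup : ∀ z ∈ upFaces hs hα, P.real (𝒞.badFace (frameUp s δ z) (faceA s δ z.1) (faceB s δ z.1) (10 * K * m) m) ≤
      C * ((m : ℝ) / S) ^ ε := fun z hz =>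
    hface 𝒞 _ _ _ m S (faceA_le_faceB hδ h2 _) hm hS
      (fun j R₁ h1 h2' => h𝒵.cleanWindow (cleanWindow_of_wallFace_fit hs hδ hα h8 (wallFace_of_mem_upFaces hz) h1 h2'))
      (fun u hu x hx1 hx2 => le_dist_far_face hs hδ hδs hα (wallFace_of_mem_upFaces hz) (hFar𝒞 u hu) hx1 hx2)
  have hdown : ∀ z ∈ downFaces hs hα, P.real (𝒞.badFace (frameDown s δ z) (faceA s δ z.1) (faceB s δ z.1) (10 * K * m) m) ≤
      C * ((m : ℝ) / S) ^ ε := fun z hz =>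
    hface 𝒞 _ _ _ m S (faceA_le_faceB hδ h2 _) hm hS
      (fun j R₁ h1 h2' => h𝒵.cleanWindow (cleanWindow_of_wallFaceBottom_fit hs hδ hα h8 (wallFaceBottom_of_mem_downFaces hz) h1 h2'))
      (fun u hu x hx1 hx2 => le_dist_far_faceBottom hs hδ hδs hα (wallFaceBottom_of_mem_downFaces hz) (hFar𝒞 u hu) hx1 hx2)
  have hright : ∀ z ∈ rightFaces hs hα, P.real (𝒞.badFace (frameRight s δ z) (faceA s δ z.2) (faceB s δ z.2) (10 * K * m) m) ≤
      C * ((m : ℝ) / S) ^ ε := fun z hz =>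
    hface 𝒞 _ _ _ m S (faceA_le_faceB hδ h2 _) hm hS
      (fun j R₁ h1 h2' => h𝒵.cleanWindow (cleanWindow_of_wallFaceRight_fit hs hδ hα h8 (wallFaceRight_of_mem_rightFaces hz) h1 h2'))
      (fun u hu x hx1 hx2 => le_dist_far_faceRight hs hδ hδs hα (wallFaceRight_of_mem_rightFaces hz) (hFar𝒞 u hu) hx1 hx2)
  have hleft : ∀ z ∈ leftFaces hs hα, P.real (𝒞.badFace (frameLeft s δ z) (faceA s δ z.2) (faceB s δ z.2) (10 * K * m) m) ≤
      C * ((m : ℝ) / S) ^ ε := fun z hz =>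
    hface 𝒞 _ _ _ m S (faceA_le_faceB hδ h2 _) hm hS
      (fun j R₁ h1 h2' => h𝒵.cleanWindow (cleanWindow_of_wallFaceLeft_fit hs hδ hα h8 (wallFaceLeft_of_mem_leftFaces hz) h1 h2'))
      (fun u hu x hx1 hx2 => le_dist_far_faceLeft hs hδ hδs hα (wallFaceLeft_of_mem_leftFaces hz) (hFar𝒞 u hu) hx1 hx2)
  -- union bounds
  have hU : ∀ (F : Finset (ℤ × ℤ)) (f : ℤ × ℤ → Set (BondConfig (Site 2))), (∀ z ∈ F, P.real (f z) ≤ C * ((m : ℝ) / S) ^ ε) →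
      P.real (⋃ z ∈ F, f z) ≤ F.card * (C * ((m : ℝ) / S) ^ ε) := by
    intro F f hf
    calc P.real (⋃ z ∈ F, f z) ≤ ∑ z ∈ F, P.real (f z) := measureReal_biUnion_finset_le _ _
      _ ≤ ∑ z ∈ F, C * ((m : ℝ) / S) ^ ε := Finset.sum_le_sum hf
      _ = F.card * (C * ((m : ℝ) / S) ^ ε) := by rw [Finset.sum_const, nsmul_eq_mul]
  have h1 := hU _ _ hup
  have h2' := hU _ _ hdown
  have h3 := hU _ _ hright
  have h4 := hU _ _ hleft
  unfold badAll numFaces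
  push_cast
  calc P.real (_ ∪ _ ∪ _ ∪ _) ≤ P.real (_ ∪ _ ∪ _) + P.real _ := measureReal_union_le _ _
    _ ≤ (P.real (_ ∪ _) + P.real _) + P.real _ := by gcongr; exact measureReal_union_le _ _
    _ ≤ ((P.real _ + P.real _) + P.real _) + P.real _ := by gcongr; exact measureReal_union_le _ _
    _ ≤ _ := by nlinarith [h1, h2', h3, h4]

end CutBlocks

end Literature.Probability.Percolation

end
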